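import Summits.ResolutionOfSingularities.ResolutionOfSingularities.Theorems.MarkedTransferCampaignW46MohWindowShadeFormalNRChartPoint
import Summits.ResolutionOfSingularities.ResolutionOfSingularities.Theorems.WildConesCampaignW46StalkChart
import Literature.AlgebraicGeometry.Resolution.RegularLocalRingsProofs
import HarnessLib

/-!
# [OURS · L1 W4.6 rung (iii-2), NON-RATIONAL POINTS, brick 4] Chart data on the stalk of a blowing up at a NON-RATIONAL closed point of
# the exceptional divisor lying on a coordinate line (scheme level)

Cell `res-hironaka`, LADDER-RESOLUTION rung L (D-0089), slot W4.6 rung (iii); seat res-L1-s46-pv-6 (gen 7). Host route MarkedTransfer,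
`--supports stmt-ResolutionOfSingularities-16155 --as helper`; kind proof (no definition). NON-RATIONAL twin of res-L1-s46-pv-2's brick 6
(`ChartPoint.exists_stalk_chartData_nzd`): the SAME Rees-chart presentation of the stalk (`IsBlowup.exists_reesChart_stalk`) — exceptional
parameter `π^♯(cᵢ)` (a non-zero-divisor), quotients `e_j` — but WITHOUT the rationality hypothesis `hrat`. Instead: the local ring
upstairs has the dimension of the centre's local ring (`dim 𝒪_{Z′,ξ′} = |σ|`; in the application both are regular of embedding dimension `3`
by o1's regime at both stages), which makes the Rees-chart prime MAXIMAL (height comparison with the tree's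
`ringKrullDim_localization_chartRing_le`), and then, for every coordinate line `{e_z = 0}` of the exceptional divisor through the point
(`e_z ∈ 𝔪`; in the application `z/uᵢ ∈ 𝔪` is forced by singularity), brick 3 (`exists_monic_of_isMaximal_localization`) delivers a monic
`π̃ ∈ 𝒪_{Z,ξ}[X]` with irreducible reduction such that `𝔪_{Z′,ξ′} = (π^♯ cᵢ, e_z, π̃^{π^♯}(e_y))` and every germ at `ξ′` is an `𝒪_{Z,ξ}`-polynomial
in `e_y` modulo `𝔪_{Z′,ξ′}` — the hypotheses of the non-rational ring-level step (`…FormalNRStepCore`). Pure scheme-level bookkeeping over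
the tree's `IsBlowup`; NOTHING here is a statement of H. Hironaka's manuscript [Hironaka2017] and nothing of it is used; no FACT-LIST
premise. AI-written; AI review is weaker than expert review. References: The Stacks Project, Tags 0804, 00FW; H. Matsumura (1986)
Thms. 13.5, 15.5; tree `BlowupStalkCharts.lean`, `BlowupDimension.lean`, `WildConesCampaignW46StalkChart.lean`. [StacksProject]
[Matsumura1987] [folklore]
-/

noncomputable section

set_option linter.dupNamespace false -- mandated namespace of this single-conjunct summit

open CategoryTheory AlgebraicGeometry TopologicalSpace IsLocalRing

namespace Summit.ResolutionOfSingularities.ResolutionOfSingularities.Theorems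

namespace CampaignW46

namespace MohWindowShadeFormalNR

open Literature.AlgebraicGeometry.Resolution
open CampaignW46.ChartPoint (mem_of_map_mem_maximalIdeal isNoetherianRing_of_chart map_mem_nonZeroDivisors_of_chart span_range_comp_equiv)

universe u

/-- Pushing an evaluated mapped polynomial along a ring map. [folklore] -/
theorem hom_eval_map {A B C : Type*} [CommRing A] [CommRing B] [CommRing C] (ψ : A →+* B) (χ : B →+* C) (P : Polynomial A) (b : B) :
    χ ((P.map ψ).eval b) = (P.map (χ.comp ψ)).eval (χ b) := by
  rw [Polynomial.eval_map, Polynomial.hom_eval₂, ← Polynomial.eval_map]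

/-! ## §1 A prime of the Rees chart over `𝔪_R` whose local ring has the dimension of `R` is maximal -/

section Maximal

variable {R : Type u} [CommRing R] [IsRegularLocalRing R] {k : ℕ} (c : Fin k → R) (j : Fin k)

/-- **A prime `𝔴` of the Rees chart `(R[𝔪t])_{(cⱼt)}` over `𝔪_R` with `ht 𝔴 = dim R` is maximal**: every prime over it lies over `𝔪_R`
too, so its height is at most `dim R` (tree `ringKrullDim_localization_chartRing_le`, Matsumura 15.5), and primes of equal finite height
in a chain coincide. [cite: Matsumura1987, Thm. 15.5] [folklore] -/
theorem isMaximal_of_height_eq (𝔴 : Ideal (chartRing c j)) [𝔴.IsPrime] (h𝔴 : 𝔴.comap (chartBase c j) = maximalIdeal R)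
    (hht : (𝔴.height : WithBot ℕ∞) = ringKrullDim R) : 𝔴.IsMaximal := by
  classical
  haveI : IsNoetherianRing (chartRing c j) := isNoetherianRing_blowupChart c j
  haveI : IsDomain R := isDomain_of_isRegularLocalRing R
  rw [Ideal.isMaximal_def]
  refine ⟨Ideal.IsPrime.ne_top inferInstance, fun J hJ => ?_⟩
  by_contra hJtop
  obtain ⟨𝔔, h𝔔max, hJ𝔔⟩ := Ideal.exists_le_maximal J hJtop
  haveI := h𝔔max.isPrime
  have h𝔴𝔔 : 𝔴 ≤ 𝔔 := hJ.le.trans hJ𝔔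
  have h𝔔 : 𝔔.comap (chartBase c j) = maximalIdeal R := by
    refine ((IsLocalRing.maximalIdeal.isMaximal R).eq_of_le (Ideal.comap_ne_top _ h𝔔max.ne_top) ?_).symm
    rw [← h𝔴]; exact Ideal.comap_mono h𝔴𝔔
  have hdim𝔔 : ringKrullDim (Localization.AtPrime 𝔔) ≤ ringKrullDim R := ringKrullDim_localization_chartRing_le c j 𝔔 h𝔔 (Localization.AtPrime 𝔔)
  rw [IsLocalization.AtPrime.ringKrullDim_eq_height 𝔔 (Localization.AtPrime 𝔔), ← hht] at hdim𝔔
  have hle : 𝔔.height ≤ 𝔴.height := by exact_mod_cast hdim𝔔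
  have heq : 𝔴 = 𝔔 := Ideal.eq_of_le_of_height_le (I := 𝔴) h𝔴𝔔 hle
  exact (lt_irrefl 𝔴) (lt_of_lt_of_le hJ (heq ▸ hJ𝔔))

end Maximal

/-! ## §2 `χ`-forms (the localisation given by an explicit ring map, as `IsBlowup.exists_reesChart_stalk` presents the stalk) -/

section ChiForm

variable {R : Type u} [CommRing R] [IsLocalRing R] {n : ℕ} (c : Fin n → R) (i : Fin n)
  (hz : Ideal.span (Set.range c) = maximalIdeal R)
  {A : Type u} [CommRing A] (ψ : R →+* A) (u : Fin n → A)
  (ε : MvPolynomial {j : Fin n // j ≠ i} (R ⧸ Ideal.span (Set.range c)) ≃+* A ⧸ Ideal.span {ψ (c i)})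
  (hεC : ∀ r : R, ε (MvPolynomial.C (Ideal.Quotient.mk (Ideal.span (Set.range c)) r)) =
    Ideal.Quotient.mk _ (ψ r))
  (hεX : ∀ j : {j : Fin n // j ≠ i}, ε (MvPolynomial.X j) = Ideal.Quotient.mk _ (u j.1))
  {y : Fin n} (hy : y ≠ i)
  (𝔓 : Ideal A) {L : Type u} [CommRing L] [IsLocalRing L] (χ : A →+* L)

omit [IsLocalRing L] in
/-- The dimension of a localisation at a prime is the height of the prime (`χ`-form). [cite: Matsumura1987, Thm. 13.5] [folklore] -/
theorem ringKrullDim_eq_height_chi [𝔓.IsPrime] (hloc : @IsLocalization.AtPrime _ _ L _ χ.toAlgebra 𝔓 _) :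
    ringKrullDim L = 𝔓.height := by
  letI : Algebra A L := χ.toAlgebra
  haveI := hloc
  exact IsLocalization.AtPrime.ringKrullDim_eq_height 𝔓 L

include hz hεC hεX hy in
/-- Brick 3 (`exists_monic_of_isMaximal_localization`) in `χ`-form, read through a ring map `g = χ ∘ ψ` (the stalk map) and names
`e_m = χ(u_m)` for the quotients; irreducibility read over the residue field of `R`. [cite: StacksProject, Tag 00FW] [folklore] -/
theorem exists_monic_of_isMaximal_chi [𝔓.IsMaximal] (h𝔓 : 𝔓.comap ψ = maximalIdeal R) (hu : ∀ j, j ≠ i → j ≠ y → u j ∈ 𝔓)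
    (hloc : @IsLocalization.AtPrime _ _ L _ χ.toAlgebra 𝔓 _) (g : R →+* L) (hg : ∀ r, χ (ψ r) = g r) (e : Fin n → L)
    (he : ∀ m, χ (u m) = e m) :
    ∃ πR : Polynomial R, πR.Monic ∧ Irreducible (πR.map (IsLocalRing.residue R)) ∧
      maximalIdeal L = (Ideal.span {g (c i)} ⊔ Ideal.span (Set.range fun j : {j : Fin n // j ≠ i ∧ j ≠ y} => e j.1)) ⊔
        Ideal.span {(πR.map g).eval (e y)} ∧
      ∀ yL : L, ∃ P : Polynomial R, yL - (P.map g).eval (e y) ∈ maximalIdeal L := by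
  letI : Algebra A L := χ.toAlgebra
  haveI := hloc
  obtain ⟨πR, hm, hirr, hgenL, hresL⟩ := exists_monic_of_isMaximal_localization c i hz ψ u ε hεC hεX hy 𝔓 h𝔓 hu L
  have halg : ∀ a, algebraMap A L a = χ a := fun a => rfl
  have hχg : χ.comp ψ = g := RingHom.ext hg
  have heval : ∀ P : Polynomial R, χ ((P.map ψ).eval (u y)) = (P.map g).eval (e y) := fun P => by
    rw [hom_eval_map, hχg, he]
  refine ⟨πR, hm, ?_, ?_, fun yL => ?_⟩
  · set θ : (R ⧸ Ideal.span (Set.range c)) ≃+* ResidueField R := Ideal.quotEquivOfEq hz with hθ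
    have hmapθ : (πR.map (Ideal.Quotient.mk (Ideal.span (Set.range c)))).map (θ : _ →+* ResidueField R) = πR.map (IsLocalRing.residue R) := by
      rw [Polynomial.map_map]
      congr 1
    rw [← hmapθ]
    exact (MulEquiv.irreducible_iff (Polynomial.mapEquiv θ)).mpr hirr
  · rw [hgenL]
    simp only [halg, hg, he, heval]
  · obtain ⟨P, hP⟩ := hresL yL
    exact ⟨P, by rw [halg, heval] at hP; exact hP⟩

end ChiForm

/-! ## §3 The stalk of a blowing up at a non-rational point on a coordinate line -/

variable {Z Z' : Scheme.{u}} {π : Z' ⟶ Z} {J : Z.IdealSheafData}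

set_option maxHeartbeats 400000 in
/-- [OURS · L1 W4.6 — DICTIONARY AT A NON-RATIONAL POINT, brick 4; replaces the role of «the local ring of the blowup `π : Z′ → Z` at a
closed point `ξ′` over the centre» (H. Hironaka, ms. 2017, Th. 16.6 p.84 l.4–10) AT A NON-RATIONAL POINT OVER A REGULAR CLOSED POINT;
NOT a statement of the manuscript] **Chart data on the stalk of a blowing up at a non-rational point on a coordinate line.** Let
`π : Z′ → Z` be a blowing up along `J`, `ξ′ ∈ Z′`, `R = 𝒪_{Z,π ξ′}` regular local with `𝔪_R = J_{π ξ′} = (c)`, `|σ| = emb.dim R`, and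
suppose `dim 𝒪_{Z′,ξ′} = |σ|`. Then there are a chart index `i` and quotients `e_j` with `π^♯(c_j) = π^♯(cᵢ) e_j`, `eᵢ = 1`, `π^♯(cᵢ)` a
non-zero-divisor, `𝒪_{Z′,ξ′}` Noetherian, and: for all indices `y ≠ z` different from `i` with `σ = {i, y, z}` and `e_z ∈ 𝔪_{Z′,ξ′}`, a
monic `π̃ ∈ R[X]` with IRREDUCIBLE reduction modulo `𝔪_R` such that `𝔪_{Z′,ξ′} = (π^♯ cᵢ, e_z, π̃^{π^♯}(e_y))` and every germ at `ξ′` is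
`≡ P̃^{π^♯}(e_y)` modulo `𝔪_{Z′,ξ′}` for some `P̃ ∈ R[X]`. [cite: StacksProject, Tag 0804] [cite: Matsumura1987, Thm. 15.5] [folklore] -/
theorem exists_stalk_chartData_nr (hπ : IsBlowup π J) (ξ' : Z')
    [IsRegularLocalRing (Z.presheaf.stalk (π ξ'))] {σ : Type} [Fintype σ] [DecidableEq σ]
    (c : σ → Z.presheaf.stalk (π ξ'))
    (hcJ : Ideal.span (Set.range c) = stalkIdeal J (π ξ'))
    (hc𝔪 : Ideal.span (Set.range c) = maximalIdeal (Z.presheaf.stalk (π ξ')))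
    (hd : (maximalIdeal (Z.presheaf.stalk (π ξ'))).spanFinrank = Fintype.card σ)
    (hdimL : ringKrullDim (Z'.presheaf.stalk ξ') = Fintype.card σ) :
    ∃ (i : σ) (e : σ → Z'.presheaf.stalk ξ'),
      (∀ j, (π.stalkMap ξ').hom (c j) = (π.stalkMap ξ').hom (c i) * e j) ∧ e i = 1 ∧
      (π.stalkMap ξ').hom (c i) ∈ nonZeroDivisors (Z'.presheaf.stalk ξ') ∧
      IsNoetherianRing (Z'.presheaf.stalk ξ') ∧
      ∀ y z : σ, y ≠ i → z ≠ i → y ≠ z → (∀ j, j = i ∨ j = y ∨ j = z) → e z ∈ maximalIdeal (Z'.presheaf.stalk ξ') →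
        ∃ πR : Polynomial (Z.presheaf.stalk (π ξ')), πR.Monic ∧ Irreducible (πR.map (IsLocalRing.residue (Z.presheaf.stalk (π ξ')))) ∧
          Ideal.span {(π.stalkMap ξ').hom (c i), e z, (πR.map (π.stalkMap ξ').hom).eval (e y)} = maximalIdeal (Z'.presheaf.stalk ξ') ∧
          ∀ yL : Z'.presheaf.stalk ξ', ∃ P : Polynomial (Z.presheaf.stalk (π ξ')),
            yL - (P.map (π.stalkMap ξ').hom).eval (e y) ∈ maximalIdeal (Z'.presheaf.stalk ξ') := by
  classical
  set g := (π.stalkMap ξ').hom with hg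
  -- reindex by `Fin k`
  set k := Fintype.card σ with hk
  set eσ : σ ≃ Fin k := Fintype.equivFin σ with heσ
  set c' : Fin k → Z.presheaf.stalk (π ξ') := c ∘ eσ.symm with hc'
  have hrange : Ideal.span (Set.range c') = Ideal.span (Set.range c) := span_range_comp_equiv eσ.symm c
  have hc'J : Ideal.span (Set.range c') = stalkIdeal J (π ξ') := hrange.trans hcJ
  have hz' : Ideal.span (Set.range c') = maximalIdeal _ := hrange.trans hc𝔪
  -- the chart presentation of the stalk
  obtain ⟨j, 𝔴, χ, hχ, hloc, h𝔴⟩ := hπ.exists_reesChart_stalk ξ' c' hc'J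
  haveI : IsNoetherianRing (chartRing c' j) := isNoetherianRing_blowupChart c' j
  have hNoeth : IsNoetherianRing (Z'.presheaf.stalk ξ') := isNoetherianRing_of_chart 𝔴.asIdeal χ hloc
  have hquasi : IsQuasiRegular c' := isQuasiRegular_rsop_comp hd c' hz' id Function.injective_id
  have hnzd : g (c (eσ.symm j)) ∈ nonZeroDivisors (Z'.presheaf.stalk ξ') := by
    have h2 : c (eσ.symm j) = c' j := by rw [hc']; simp
    rw [h2, hg, ← hχ]
    exact map_mem_nonZeroDivisors_of_chart 𝔴.asIdeal χ hloc
      (reesChartBase_mem_nonZeroDivisors (c' j) (Ideal.mem_span_range_self (f := c') (x := j)))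
  have hχg : χ.comp (chartBase c' j) = g := RingHom.ext hχ
  -- maximality of the Rees-chart prime from the dimension upstairs
  have hdimR : ringKrullDim (Z.presheaf.stalk (π ξ')) = Fintype.card σ := by
    have h := IsRegularLocalRing.spanFinrank_maximalIdeal (R := Z.presheaf.stalk (π ξ'))
    rw [hd] at h; exact h.symm
  haveI h𝔴max : 𝔴.asIdeal.IsMaximal := by
    refine isMaximal_of_height_eq c' j 𝔴.asIdeal h𝔴 ?_
    rw [← ringKrullDim_eq_height_chi 𝔴.asIdeal χ hloc, hdimL, hdimR]
  refine ⟨eσ.symm j, fun s => χ (chartGen c' j (eσ s)), fun s => ?_, ?_, hnzd, hNoeth, ?_⟩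
  · have h1 : c s = c' (eσ s) := by rw [hc']; simp
    have h2 : c (eσ.symm j) = c' j := by rw [hc']; simp
    rw [h1, h2, ← hχ, ← hχ, reesChartBase_apply_eq_mul_chartGen c' j (eσ s), map_mul]
  · dsimp only
    have h1 : chartGen c' j j = 1 := chartGen_self c' j
    rw [Equiv.apply_symm_apply, h1, map_one]
  · intro y z hy hzi hyz hall hez
    have hy' : eσ y ≠ j := fun h => hy (by rw [← h]; simp)
    have hu : ∀ m, m ≠ j → m ≠ eσ y → chartGen c' j m ∈ 𝔴.asIdeal := by
      intro m hmj hmy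
      have hm : eσ.symm m = z := by
        rcases hall (eσ.symm m) with h | h | h
        · exact absurd (eσ.symm.injective h) hmj
        · exact absurd (by rw [← h]; simp) hmy
        · exact h
      have hm' : m = eσ z := by rw [← hm]; simp
      rw [hm']
      exact mem_of_map_mem_maximalIdeal 𝔴.asIdeal χ hloc hez
    obtain ⟨πR, hm, hirr, hgenL, hresL⟩ := exists_monic_of_isMaximal_chi c' j hz' (chartBase c' j) (chartGen c' j)
      (chartQuotEquiv c' j hquasi) (chartQuotMap_C c' j) (chartQuotMap_X c' j) hy' 𝔴.asIdeal χ h𝔴 hu hloc g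
      (fun r => by rw [hχ, hg]) (fun m => χ (chartGen c' j m)) (fun m => rfl)
    refine ⟨πR, hm, hirr, ?_, fun yL => ?_⟩
    · -- generators
      have h2 : c (eσ.symm j) = c' j := by rw [hc']; simp
      rw [hgenL]
      have hrangef : Set.range (fun m : {m : Fin k // m ≠ j ∧ m ≠ eσ y} => χ (chartGen c' j m.1)) = {χ (chartGen c' j (eσ z))} := by
        ext t
        simp only [Set.mem_range, Set.mem_singleton_iff]
        constructor
        · rintro ⟨m, rfl⟩
          obtain ⟨m, hmj, hmy⟩ := m
          have hm : eσ.symm m = z := by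
            rcases hall (eσ.symm m) with h | h | h
            · exact absurd (eσ.symm.injective h) hmj
            · exact absurd (by rw [← h]; simp) hmy
            · exact h
          have hm' : m = eσ z := by rw [← hm]; simp
          simp only [hm']
        · rintro rfl
          have hzj : eσ z ≠ j := fun h => hzi (by rw [← h]; simp)
          have hzy : eσ z ≠ eσ y := fun h => hyz (eσ.injective h).symm
          exact ⟨⟨eσ z, hzj, hzy⟩, rfl⟩
      rw [hrangef]
      dsimp only
      rw [h2, Ideal.span_insert, Ideal.span_insert, sup_assoc]
    · obtain ⟨P, hP⟩ := hresL yL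
      exact ⟨P, hP⟩

end MohWindowShadeFormalNR

end CampaignW46

end Summit.ResolutionOfSingularities.ResolutionOfSingularities.Theorems

end
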